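import Literature.NumberTheory.Transcendental.OnePeriodsClosedPathsRational
import Literature.NumberTheory.Transcendental.OnePeriodsClosedPathsConics
import Mathlib.Analysis.Calculus.MeanValue
import HarnessLib

/-!
# Complete periods of plane curves: curves of degree `≤ 1` in one variable

Companion of `Literature/NumberTheory/Transcendental/OnePeriodsClosedPaths.lean` (the named fact
`Literature.NumberTheory.Transcendental.completePlaneCurvePeriods_zero_or_transcendental`:
complete periods `S = Σᵢ nᵢ ∮_{γᵢ} (A dx + B dy)` of polynomial `1`-forms over `ℚ` along closed
`C¹` loops in the smooth locus of a plane curve `p = 0` over `ℚ` are `0` or transcendental;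
Huber–Wüstholz, *Transcendence and Linear Relations of 1-Periods*, Cambridge Tracts 227 (2022),
Cor. 13.13, p. 126 of the held text), of `OnePeriodsClosedPathsRational.lean` (graphs of
rational functions, residues along loops) and of `OnePeriodsClosedPathsConics.lean` (lines,
connectedness dichotomy).

Here the named fact is PROVED outright for every `p ∈ ℚ[x, y]` of degree `≤ 1` in `y`
(`completePlaneCurvePeriods_zero_or_transcendental_of_degreeOf_le_one`) and, symmetrically, of
degree `≤ 1` in `x` (`…_of_degreeOf_zero_le_one`) — an intrinsic family containing all lines,
the hyperbola `xy = 1`, and all graphs `y q(x) = r(x)` WITHOUT any coprimality assumption.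
Write `p = y q(x) − r(x)` and `g = gcd(q, r)`, `q = g q₁`, `r = g r₁` with `q₁, r₁` coprime:
then `p = g(x) (y q₁(x) − r₁(x))`, the smooth locus is the disjoint union of the vertical lines
`x = c` (`g(c) = 0`, minus finitely many points) and of the graph of `r₁/q₁` (minus the points
above the roots of `g`); a loop stays on one piece (connectedness; on a vertical piece `x′ ≡ 0`
because `g′(x) ≠ 0` there), vertical loops have zero periods, graph loops have periods
`2πi Σ_ρ c_ρ wind(x − ρ)` with the residues `c_ρ ∈ ℚ̄` of
`ClosedPathPeriods.exists_residues_of_ratGraph`, so `S ∈ ℚ̄ · 2πi` and Lindemann's theorem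
concludes.  (Huber–Wüstholz, Remark 13.10: in genus `0` the theorem is the transcendence of
`π`.)

## References

* A. Huber, G. Wüstholz, *Transcendence and Linear Relations of 1-Periods*, Cambridge Tracts in
  Mathematics 227, CUP 2022, doi:10.1017/9781009019729 [HuberWustholz2022]: Cor. 13.13 (p. 126),
  Thm. 13.9 and Remark 13.10 (p. 125).
* F. Lindemann, *Über die Zahl π*, Math. Ann. 20 (1882) [Lindemann1882].
-/

noncomputable section

open MvPolynomial Complex
open scoped Real Polynomial

namespace Literature.NumberTheory.Transcendental

namespace ClosedPathPeriods

open Literature.Topology.PlaneTopology Literature.Analysis.Complex IntermediateField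

/-! ### Polynomials of degree `≤ 1` in `y` -/

/-- **A polynomial of degree `≤ 1` in `y` is `y q(x) − r(x)`.** [folklore] -/
theorem exists_eq_of_degreeOf_one_le_one {p : MvPolynomial (Fin 2) ℚ} (hp : p.degreeOf 1 ≤ 1) :
    ∃ q r : ℚ[X], p = X 1 * Polynomial.aeval (X 0 : MvPolynomial (Fin 2) ℚ) q -
      Polynomial.aeval (X 0 : MvPolynomial (Fin 2) ℚ) r := by
  have key : ∀ v ∈ p.support, ∃ q r : ℚ[X], (monomial v (coeff v p) : MvPolynomial (Fin 2) ℚ) =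
      X 1 * Polynomial.aeval (X 0 : MvPolynomial (Fin 2) ℚ) q -
        Polynomial.aeval (X 0 : MvPolynomial (Fin 2) ℚ) r := by
    intro v hv
    have h1 : v 1 ≤ 1 := (monomial_le_degreeOf 1 hv).trans hp
    rw [monomial_fin_two]
    generalize coeff v p = c
    generalize hj : v 1 = j at h1
    interval_cases j
    · refine ⟨0, -(Polynomial.C c * Polynomial.X ^ (v 0)), ?_⟩
      simp only [pow_zero, mul_one, map_zero, mul_zero, map_neg, map_mul, Polynomial.aeval_C,
        map_pow, Polynomial.aeval_X, zero_sub, neg_neg, algebraMap_eq]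
    · refine ⟨Polynomial.C c * Polynomial.X ^ (v 0), 0, ?_⟩
      simp only [pow_one, map_mul, Polynomial.aeval_C, map_pow, Polynomial.aeval_X, map_zero,
        sub_zero, algebraMap_eq]
      ring
  suffices h : ∃ q r : ℚ[X], (∑ v ∈ p.support, monomial v (coeff v p)) =
      X 1 * Polynomial.aeval (X 0 : MvPolynomial (Fin 2) ℚ) q -
        Polynomial.aeval (X 0 : MvPolynomial (Fin 2) ℚ) r by
    rwa [← p.as_sum] at h
  refine Finset.sum_induction _ (fun P : MvPolynomial (Fin 2) ℚ => ∃ q r : ℚ[X],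
      P = X 1 * Polynomial.aeval (X 0 : MvPolynomial (Fin 2) ℚ) q -
        Polynomial.aeval (X 0 : MvPolynomial (Fin 2) ℚ) r) ?_ ?_ key
  · rintro P P' ⟨q, r, rfl⟩ ⟨q', r', rfl⟩
    exact ⟨q + q', r + r', by simp only [map_add]; ring⟩
  · exact ⟨0, 0, by simp⟩

/-- Evaluating `q(x)` (a one-variable polynomial in the first coordinate) at a point of `ℂ²`.
[folklore] -/
theorem aeval_polynomial_aeval_X (z : Fin 2 → ℂ) (q : ℚ[X]) (i : Fin 2) :
    aeval z (Polynomial.aeval (X i : MvPolynomial (Fin 2) ℚ) q) = Polynomial.aeval (z i) q := by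
  rw [← Polynomial.aeval_algHom_apply, aeval_X]

/-- **Chain rule for a one-variable substitution**: `∂ⱼ q(xᵢ) = q′(xᵢ) ∂ⱼ xᵢ`. [folklore] -/
theorem pderiv_polynomial_aeval_X {σ : Type*} (i j : σ) (q : ℚ[X]) :
    pderiv j (Polynomial.aeval (X i : MvPolynomial σ ℚ) q) =
      Polynomial.aeval (X i : MvPolynomial σ ℚ) (Polynomial.derivative q) * pderiv j (X i) := by
  induction q using Polynomial.induction_on' with
  | add p q hp hq => simp only [map_add, hp, hq, add_mul]
  | monomial n c =>
    simp only [Polynomial.aeval_monomial, algebraMap_eq, Derivation.leibniz, Derivation.leibniz_pow,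
      pderiv_C, smul_eq_mul, nsmul_eq_mul, Polynomial.derivative_monomial, map_mul, map_natCast]
    ring

/-- The `x`-derivative of `y q(x) − r(x)` at a point. [folklore] -/
theorem aeval_pderiv_zero_linY (q r : ℚ[X]) (z : Fin 2 → ℂ) :
    aeval z (pderiv 0 (X 1 * Polynomial.aeval (X 0 : MvPolynomial (Fin 2) ℚ) q -
      Polynomial.aeval (X 0 : MvPolynomial (Fin 2) ℚ) r)) =
      z 1 * Polynomial.aeval (z 0) (Polynomial.derivative q) -
        Polynomial.aeval (z 0) (Polynomial.derivative r) := by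
  rw [map_sub, Derivation.leibniz, pderiv_polynomial_aeval_X, pderiv_polynomial_aeval_X,
    pderiv_X_self, pderiv_X_of_ne (R := ℚ) (i := (0 : Fin 2)) (j := (1 : Fin 2)) (by decide)]
  simp only [mul_one, mul_zero, smul_eq_mul, add_zero, map_sub, map_mul, aeval_X,
    aeval_polynomial_aeval_X]

/-- The `y`-derivative of `y q(x) − r(x)` at a point. [folklore] -/
theorem aeval_pderiv_one_linY (q r : ℚ[X]) (z : Fin 2 → ℂ) :
    aeval z (pderiv 1 (X 1 * Polynomial.aeval (X 0 : MvPolynomial (Fin 2) ℚ) q -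
      Polynomial.aeval (X 0 : MvPolynomial (Fin 2) ℚ) r)) = Polynomial.aeval (z 0) q := by
  rw [map_sub, Derivation.leibniz, pderiv_polynomial_aeval_X, pderiv_polynomial_aeval_X,
    pderiv_X_self, pderiv_X_of_ne (R := ℚ) (i := (1 : Fin 2)) (j := (0 : Fin 2)) (by decide)]
  simp only [mul_zero, smul_eq_mul, zero_add, sub_zero, aeval_polynomial_aeval_X, mul_one]

/-! ### Vertical loops -/

section Vertical

variable {R : Type*} [CommRing R] [Algebra R ℂ]
variable {γ : ℝ → (Fin 2 → ℂ)}

/-- **Loops on a vertical line have zero complete periods**: if `g(x) ≡ 0` and `g′(x) ≠ 0`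
along a `C¹` loop (`g ∈ ℚ[x]`), then `x′ ≡ 0`, `x` is constant and every polynomial form
restricts to an exact form in `y`. [folklore] -/
theorem integral_form_eq_zero_of_vertical (hγ : ContDiff ℝ 1 γ) (hper : Function.Periodic γ 1)
    (g : ℚ[X]) (hg0 : ∀ t, Polynomial.aeval (γ t 0) g = 0)
    (hg1 : ∀ t, Polynomial.aeval (γ t 0) (Polynomial.derivative g) ≠ 0)
    (A B : MvPolynomial (Fin 2) R) :
    (∫ t in (0:ℝ)..1, (aeval (γ t) A * deriv (fun s => γ s 0) t +
        aeval (γ t) B * deriv (fun s => γ s 1) t)) = 0 := by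
  have hx1 : ContDiff ℝ 1 fun t => γ t 0 := contDiff_pi.1 hγ 0
  have hxdiff : Differentiable ℝ fun t => γ t 0 := hx1.differentiable one_ne_zero
  have hxd : ∀ t, deriv (fun s => γ s 0) t = 0 := by
    intro t
    have h := ((g.hasDerivAt_aeval (γ t 0)).comp t (hxdiff t).hasDerivAt).deriv
    have hconst : ((fun x => Polynomial.aeval x g) ∘ fun s => γ s 0) = fun _ => (0 : ℂ) :=
      funext fun s => hg0 s
    rw [hconst, deriv_const] at h
    exact (mul_eq_zero.1 h.symm).resolve_left (hg1 t)
  have hconst : ∀ t, γ t 0 = γ 0 0 := fun t => is_const_of_deriv_eq_zero hxdiff hxd t 0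
  refine integral_form_eq_zero_of_graph' hγ hper (Polynomial.C (γ 0 0)) (fun t => ?_) A B
  rw [Polynomial.eval_C]
  exact hconst t

end Vertical

/-- A one-variable polynomial along the first coordinate of a `C¹` loop is continuous. [folklore] -/
theorem continuous_polynomial_aeval_fst {γ : ℝ → (Fin 2 → ℂ)} (hγ : ContDiff ℝ 1 γ) (g : ℚ[X]) :
    Continuous fun t => Polynomial.aeval (γ t 0) g := by
  have h := (g.map (algebraMap ℚ ℂ)).continuous.comp (contDiff_pi.1 hγ 0).continuous
  simpa only [Function.comp_def, Polynomial.eval_map, ← Polynomial.aeval_def] using h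

end ClosedPathPeriods

open Literature.Topology.PlaneTopology in
/-- **The named fact for curves of degree `≤ 1` in `y` is a theorem**:
`completePlaneCurvePeriods_zero_or_transcendental` holds for every `p ∈ ℚ[x, y]` with
`deg_y p ≤ 1`, unconditionally — `p = y q(x) − r(x)` with arbitrary `q, r ∈ ℚ[x]` (lines,
`xy = 1`, graphs of rational functions together with the vertical lines over the common roots of
`q` and `r`).  With `g = gcd(q, r)` the smooth locus splits into vertical lines (zero periods:
`ClosedPathPeriods.integral_form_eq_zero_of_vertical`) and the graph of the coprime quotient
`r₁/q₁` (periods `2πi Σ_ρ c_ρ wind(x − ρ)`, `c_ρ ∈ ℚ̄`: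
`ClosedPathPeriods.exists_residues_of_ratGraph`); a loop stays on one piece, so the complete
period lies in `ℚ̄ · 2πi` and vanishes when algebraic (Lindemann).  The genus-`0` case
"transcendence of `π`" of Huber–Wüstholz, Thm. 13.9 / Cor. 13.13 (Remark 13.10).
[cite: HuberWustholz2022, Cor. 13.13 (p. 126) and Remark 13.10 (p. 125); Lindemann1882] -/
theorem completePlaneCurvePeriods_zero_or_transcendental_of_degreeOf_le_one
    (p A B : MvPolynomial (Fin 2) ℚ) (hp : p.degreeOf 1 ≤ 1) (k : ℕ) (n : Fin k → ℤ)
    (γ : Fin k → ℝ → (Fin 2 → ℂ))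
    (hγ : ∀ i, ContDiff ℝ 1 (γ i) ∧ Function.Periodic (γ i) 1 ∧
      ∀ t, aeval (γ i t) p = 0 ∧ ∃ j, aeval (γ i t) (pderiv j p) ≠ 0)
    (halg : IsAlgebraic ℚ (∑ i, (n i : ℂ) * ∫ t in (0:ℝ)..1,
      (aeval (γ i t) A * deriv (fun s => γ i s 0) t +
        aeval (γ i t) B * deriv (fun s => γ i s 1) t))) :
    (∑ i, (n i : ℂ) * ∫ t in (0:ℝ)..1,
      (aeval (γ i t) A * deriv (fun s => γ i s 0) t +
        aeval (γ i t) B * deriv (fun s => γ i s 1) t)) = 0 := by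
  classical
  obtain ⟨q, r, rfl⟩ := ClosedPathPeriods.exists_eq_of_degreeOf_one_le_one hp
  -- the curve data: `y q(x) = r(x)` and `(y q′(x) − r′(x), q(x)) ≠ (0, 0)`
  have hon : ∀ i t, γ i t 1 * Polynomial.aeval (γ i t 0) q = Polynomial.aeval (γ i t 0) r := by
    intro i t
    have h := ((hγ i).2.2 t).1
    rw [map_sub, map_mul, aeval_X, ClosedPathPeriods.aeval_polynomial_aeval_X,
      ClosedPathPeriods.aeval_polynomial_aeval_X, sub_eq_zero] at h
    exact h
  have hsm : ∀ i t, ¬(γ i t 1 * Polynomial.aeval (γ i t 0) (Polynomial.derivative q) -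
      Polynomial.aeval (γ i t 0) (Polynomial.derivative r) = 0 ∧
        Polynomial.aeval (γ i t 0) q = 0) := by
    rintro i t ⟨h0, h1⟩
    obtain ⟨j, hj⟩ := ((hγ i).2.2 t).2
    apply hj
    fin_cases j
    · rw [Fin.zero_eta, ClosedPathPeriods.aeval_pderiv_zero_linY]
      exact h0
    · rw [Fin.mk_one, ClosedPathPeriods.aeval_pderiv_one_linY]
      exact h1
  by_cases hq : q = 0
  · -- `p = -r(x)`: every loop is vertical
    subst hq
    refine Finset.sum_eq_zero fun i _ => ?_
    rw [ClosedPathPeriods.integral_form_eq_zero_of_vertical (hγ i).1 (hγ i).2.1 r (fun t => ?_)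
      (fun t h => hsm i t ⟨?_, by simp⟩) A B, mul_zero]
    · have h := hon i t
      rw [map_zero, mul_zero] at h
      exact h.symm
    · rw [Polynomial.derivative_zero, map_zero, mul_zero, h, sub_zero]
  -- `q ≠ 0`: factor out `g = gcd(q, r)`
  set g : ℚ[X] := EuclideanDomain.gcd q r with hg
  have hg0 : g ≠ 0 := fun h => hq (EuclideanDomain.gcd_eq_zero_iff.1 h).1
  set q₁ : ℚ[X] := q / g with hq₁
  set r₁ : ℚ[X] := r / g with hr₁
  have hqg : g * q₁ = q := EuclideanDomain.mul_div_cancel' hg0 (EuclideanDomain.gcd_dvd_left q r)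
  have hrg : g * r₁ = r := EuclideanDomain.mul_div_cancel' hg0 (EuclideanDomain.gcd_dvd_right q r)
  have hcop : IsCoprime q₁ r₁ := by
    refine ⟨EuclideanDomain.gcdA q r, EuclideanDomain.gcdB q r, mul_left_cancel₀ hg0 ?_⟩
    rw [mul_one]
    calc g * (EuclideanDomain.gcdA q r * q₁ + EuclideanDomain.gcdB q r * r₁) =
        g * q₁ * EuclideanDomain.gcdA q r + g * r₁ * EuclideanDomain.gcdB q r := by ring
      _ = q * EuclideanDomain.gcdA q r + r * EuclideanDomain.gcdB q r := by rw [hqg, hrg]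
      _ = g := by rw [hg]; exact (EuclideanDomain.gcd_eq_gcd_ab q r).symm
  have hq1 : q₁ ≠ 0 := fun h => hq (by rw [← hqg, h, mul_zero])
  obtain ⟨s, c, hsc⟩ := ClosedPathPeriods.exists_residues_of_ratGraph q₁ r₁ hcop hq1 A B
  -- each complete period is `(Σ_ρ c_ρ m_ρ) · 2πi` with integers `m_ρ`
  have hI : ∀ i, ∃ m : algebraicClosure ℚ ℂ → ℤ,
      (∫ t in (0:ℝ)..1, (aeval (γ i t) A * deriv (fun s => γ i s 0) t +
        aeval (γ i t) B * deriv (fun s => γ i s 1) t)) =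
        (∑ ρ ∈ s, (c ρ : ℂ) * (m ρ : ℂ)) * (2 * π * I) := by
    intro i
    obtain ⟨hC1, hper, hcurve⟩ := hγ i
    -- `q′ = g′ q₁ + g q₁′`, `r′ = g′ r₁ + g r₁′` along the loop
    have hdq : ∀ t, Polynomial.aeval (γ i t 0) (Polynomial.derivative q) =
        Polynomial.aeval (γ i t 0) (Polynomial.derivative g) * Polynomial.aeval (γ i t 0) q₁ +
          Polynomial.aeval (γ i t 0) g * Polynomial.aeval (γ i t 0) (Polynomial.derivative q₁) := by
      intro t
      rw [← hqg, Polynomial.derivative_mul, map_add, map_mul, map_mul]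
    have hdr : ∀ t, Polynomial.aeval (γ i t 0) (Polynomial.derivative r) =
        Polynomial.aeval (γ i t 0) (Polynomial.derivative g) * Polynomial.aeval (γ i t 0) r₁ +
          Polynomial.aeval (γ i t 0) g * Polynomial.aeval (γ i t 0) (Polynomial.derivative r₁) := by
      intro t
      rw [← hrg, Polynomial.derivative_mul, map_add, map_mul, map_mul]
    -- `g(x) · (y q₁(x) − r₁(x)) = 0`, never both factors zero on the smooth locus
    have hmul : ∀ t, Polynomial.aeval (γ i t 0) g *
        (γ i t 1 * Polynomial.aeval (γ i t 0) q₁ - Polynomial.aeval (γ i t 0) r₁) = 0 := by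
      intro t
      have h := hon i t
      rw [← hqg, ← hrg, map_mul, map_mul] at h
      linear_combination h
    have hne : ∀ t, ¬(Polynomial.aeval (γ i t 0) g = 0 ∧
        γ i t 1 * Polynomial.aeval (γ i t 0) q₁ - Polynomial.aeval (γ i t 0) r₁ = 0) := by
      rintro t ⟨h1, h2⟩
      refine hsm i t ⟨?_, ?_⟩
      · rw [hdq t, hdr t, h1]
        linear_combination Polynomial.aeval (γ i t 0) (Polynomial.derivative g) * h2
      · rw [← hqg, map_mul, h1, zero_mul]
    have hcg : Continuous fun t => Polynomial.aeval (γ i t 0) g :=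
      ClosedPathPeriods.continuous_polynomial_aeval_fst hC1 g
    have hch : Continuous fun t => γ i t 1 * Polynomial.aeval (γ i t 0) q₁ -
        Polynomial.aeval (γ i t 0) r₁ :=
      (((continuous_apply 1).comp hC1.continuous).mul
        (ClosedPathPeriods.continuous_polynomial_aeval_fst hC1 q₁)).sub
        (ClosedPathPeriods.continuous_polynomial_aeval_fst hC1 r₁)
    rcases ClosedPathPeriods.forall_or_forall_of_mul_eq_zero hcg hch hmul hne with hv | hgr
    · -- vertical loop: `g(x) ≡ 0`, `g′(x) ≠ 0`
      refine ⟨fun _ => 0, ?_⟩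
      have hg1 : ∀ t, Polynomial.aeval (γ i t 0) (Polynomial.derivative g) ≠ 0 := by
        intro t h1
        refine hsm i t ⟨?_, ?_⟩
        · rw [hdq t, hdr t, hv t, h1]
          ring
        · rw [← hqg, map_mul, hv t, zero_mul]
      rw [ClosedPathPeriods.integral_form_eq_zero_of_vertical hC1 hper g hv hg1 A B]
      simp
    · -- graph loop: residues
      refine ⟨fun ρ => wind fun t => γ i t 0 - (ρ : ℂ), ?_⟩
      exact (hsc (γ i) hC1 hper fun t => by linear_combination hgr t).2
  choose m hm using hI
  have hS : (∑ i, (n i : ℂ) * ∫ t in (0:ℝ)..1, (aeval (γ i t) A * deriv (fun s => γ i s 0) t +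
      aeval (γ i t) B * deriv (fun s => γ i s 1) t)) =
      ((∑ ρ ∈ s, c ρ * ((∑ i, n i * m i ρ : ℤ) : algebraicClosure ℚ ℂ) :
        algebraicClosure ℚ ℂ) : ℂ) * (2 * π * I) := by
    simp_rw [hm]
    push_cast
    simp_rw [Finset.mul_sum, Finset.sum_mul, Finset.mul_sum]
    rw [Finset.sum_comm]
    refine Finset.sum_congr rfl fun ρ _ => Finset.sum_congr rfl fun i _ => ?_
    ring
  rw [hS] at halg ⊢
  rw [ClosedPathPeriods.eq_zero_of_isAlgebraic_mul_two_pi_I (mem_algebraicClosure_iff.1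
    (SetLike.coe_mem _)) halg, zero_mul]

/-- **The named fact for curves of degree `≤ 1` in `x` is a theorem** (`p = x q(y) − r(y)`),
by the symmetry `x ↔ y` (`completePlaneCurvePeriods_of_swap`).
[cite: HuberWustholz2022, Cor. 13.13 (p. 126) and Remark 13.10 (p. 125); Lindemann1882] -/
theorem completePlaneCurvePeriods_zero_or_transcendental_of_degreeOf_zero_le_one
    (p A B : MvPolynomial (Fin 2) ℚ) (hp : p.degreeOf 0 ≤ 1) (k : ℕ) (n : Fin k → ℤ)
    (γ : Fin k → ℝ → (Fin 2 → ℂ))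
    (hγ : ∀ i, ContDiff ℝ 1 (γ i) ∧ Function.Periodic (γ i) 1 ∧
      ∀ t, aeval (γ i t) p = 0 ∧ ∃ j, aeval (γ i t) (pderiv j p) ≠ 0)
    (halg : IsAlgebraic ℚ (∑ i, (n i : ℂ) * ∫ t in (0:ℝ)..1,
      (aeval (γ i t) A * deriv (fun s => γ i s 0) t +
        aeval (γ i t) B * deriv (fun s => γ i s 1) t))) :
    (∑ i, (n i : ℂ) * ∫ t in (0:ℝ)..1,
      (aeval (γ i t) A * deriv (fun s => γ i s 0) t +
        aeval (γ i t) B * deriv (fun s => γ i s 1) t)) = 0 := by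
  refine completePlaneCurvePeriods_of_swap p (fun A' B' k' n' γ' hγ' halg' => ?_) A B k n γ hγ halg
  have hp' : (rename (Equiv.swap (0 : Fin 2) 1) p).degreeOf 1 ≤ 1 := by
    have h := degreeOf_rename_of_injective (Equiv.swap (0 : Fin 2) 1).injective (p := p) 0
    rw [Equiv.swap_apply_left] at h
    rw [h]
    exact hp
  exact completePlaneCurvePeriods_zero_or_transcendental_of_degreeOf_le_one _ A' B' hp' k' n' γ'
    hγ' halg'

end Literature.NumberTheory.Transcendental

end
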